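import Literature.AlgebraicGeometry.Crystalline.FermatLiftSeedDefs
import Summits.HodgeConjecture.HodgeConjecture.Theorems.PadicSemiregularLiftAnchorsAtGenericHodgeLocusPointsFermatPrimes
import Summits.HodgeConjecture.HodgeConjecture.Theorems.PadicSemiregularLiftAnchorsAtGenericHodgeLocusPointsCutOutBaseChange
import Summits.HodgeConjecture.HodgeConjecture.Theorems.PadicSemiregularLiftAnchorsAtGenericHodgeLocusPointsFermatLiftModel
import HarnessLib

/-!
# The Fermat lift over `W(k)` exists (helper for `AnchorsAtGenericHodgeLocusPoints`, stmt-HodgeConjecture-13944)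

Route `PadicSemiregularLift` of `HodgeConjecture`, informal support item P2b
`AnchorsAtGenericHodgeLocusPoints`, Fermat half (B2): "for `Y = Xⁿₘ ⊂ ℙⁿ⁺¹_ℂ`, every Hodge class
`β` on `Y` and every prime `p ≡ -1 (mod m)`, `p > n + 6`: `𝒳 = Xⁿₘ` over `W(𝔽̄_p)` is a `p`-adic
anchor …". The item has no Lean signature; since 2026-08-16 the tree carries the importable
vocabulary in which its Fermat half is phrased
(`Literature/AlgebraicGeometry/Crystalline/FermatLiftSeedDefs.lean`): a `W(k)`-scheme `𝒳` IS A
FERMAT LIFT, `Crystalline.IsFermatLift n m 𝒳`, if it admits a closed `W(k)`-immersion into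
`ℙⁿ⁺¹_{W(k)} = Crystalline.projectiveSpaceOver (n + 1) (W k)` whose image is the zero locus
`V₊(x₀ᵐ + ⋯ + x_{n+1}ᵐ)`; the (F)-anchors of `IsRestrictedAnchor` / `SemiregularSeedsOnFermatLifts`
are the `p`-adic anchors that are Fermat lifts with `2 ≤ m`, `1 ≤ ν`, `m ∣ p ^ ν + 1`.

This file discharges, sorry-free and over real carriers, the MODEL-EXISTENCE clause of (B2) that the
earlier helper `…FermatPrimes.lean` left open ("the `W(𝔽̄_p)`-model"):

* `exists_isFermatLift` — by `…CutOutBaseChange.exists_closedImmersion_range_eq_zeroLocus` (every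
  zero locus `V₊(S) ⊆ ℙᴺ_O` over ANY commutative ring underlies a closed `O`-subscheme, the reduced
  induced structure; Hartshorne II Example 3.2.6), for every prime `p`, perfect field `k` of characteristic `p` and all
  `n, m` there is a Fermat lift `𝒳 / W(k)`, `IsFermatLift n m 𝒳`, projective over the ring `W(k)`
  (`IsProjectiveOverRing 𝒳`, a field of `IsPadicAnchor`);
* `exists_isFermatLift_dvd_pow_add_one` — at a prime `p ≡ -1 (mod m)`, `m ≥ 2`, that lift
  satisfies the (F)-clause `∃ m ν, 2 ≤ m ∧ 1 ≤ ν ∧ m ∣ p ^ ν + 1 ∧ IsFermatLift n m 𝒳` of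
  `IsRestrictedAnchor` verbatim (`ν = 1`, `…FermatPrimes.dvd_add_one_of_eq_neg_one`);
* `exists_fermat_anchor_prime_and_lift` — (B2)'s arithmetic and model-existence clauses packaged:
  for `n ≥ 1`, `m ≥ 2` there are a prime `p > n + 6` with `p ≡ -1 (mod m)`, `p ∤ m`, a smooth
  projective special Fermat `n`-fold `Xⁿₘ ⊗ 𝔽̄_p`, AND a Fermat lift over `W(𝔽̄_p)` meeting the
  (F)-clause;
* `exists_isFermatLift_smoothProperModel` — the SMOOTH PROPER Fermat lift of `…FermatLiftModel.lean`
  (`IsSmoothProperModel`, Fermat fibres) phrased over `IsFermatLift`;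
* `exists_fermat_restrictedAnchor_of_crystalline` — at an anchor prime that lift is a RESTRICTED ANCHOR
  (`Crystalline.IsRestrictedAnchor C n 𝒳`) for every crystalline realization `C` granted the two residual
  classical facts (cohomological supersingularity of `Xⁿₘ ⊗ 𝔽̄_p`; torsion-free Hodge cohomology of `𝒳/W`):
  precisely what remains of (B2)'s anchor.

What remains of (B2) is exactly its three inputs from print, which are hypotheses on the classical
crystalline package `C` in the tree's convention (the last theorem displays two of them as such) (`IsPadicAnchor C n 𝒳`: cohomological
supersingularity of `Xⁿₘ ⊗ 𝔽̄_p` — Shioda–Katsura 1979 §3 with Tate 1965; torsion-free Hodge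
cohomology of the smooth hypersurface `𝒳 / W`; and "`β_dR` is `φ`-Tate on the nose" — Ogus 1982,
Thm. 4.14), none of which has a carrier-level proof in the tree.

References: R. Hartshorne, *Algebraic Geometry* (1977), II Example 3.2.6, II §4 [Hartshorne1977];
T. Shioda, T. Katsura, *On Fermat varieties*, Tôhoku Math. J. 31 (1979) §3 [ShiodaKatsura1979];
A. Ogus, *Hodge cycles and crystalline cohomology*, LNM 900 (1982), Thm. 4.14 [Ogus1982].
-/

-- the summit-side namespace `Summit.HodgeConjecture.HodgeConjecture.…` (summit = sub-problem, D-0017)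
-- repeats a component by design; the linter would flag every declaration.
set_option linter.dupNamespace false

noncomputable section

open CategoryTheory AlgebraicGeometry
open scoped Isocrystal
open Literature.AlgebraicGeometry.Motives Literature.AlgebraicGeometry.Motives.WittScheme
  Literature.AlgebraicGeometry.Crystalline

universe u

namespace Summit.HodgeConjecture.HodgeConjecture.Theorems.AnchorsAtGenericHodgeLocusPoints

/-! ### The Fermat lift over `W(k)` -/

section Witt

variable (p : ℕ) [Fact p.Prime] (k : Type u) [Field k]

/-- **The Fermat lift exists.** For every prime `p`, perfect field `k` of characteristic `p` and all
`n, m`, the zero locus `V₊(x₀ᵐ + ⋯ + x_{n+1}ᵐ) ⊆ ℙⁿ⁺¹_{W(k)}` with its reduced induced structure is a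
`W(k)`-scheme `𝒳` which is a Fermat lift (`Crystalline.IsFermatLift n m 𝒳`) and projective over the
ring `W(k)` (`Crystalline.IsProjectiveOverRing 𝒳`). [cite: Hartshorne1977, II Example 3.2.6] -/
theorem exists_isFermatLift (n m : ℕ) :
    ∃ 𝒳 : SchemeOver (WittVector p k), IsFermatLift n m 𝒳 ∧ IsProjectiveOverRing 𝒳 := by
  obtain ⟨𝒳, ι, hι, hrange⟩ := exists_closedImmersion_range_eq_zeroLocus
    (O := WittVector p k) (N := n + 1) {∑ i : Fin (n + 2), MvPolynomial.X i ^ m}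
  exact ⟨𝒳, ⟨ι, hι, hrange⟩, ⟨n + 1, ι, hι⟩⟩

/-- **The Fermat lift at a prime `p ≡ -1 (mod m)` meets the (F)-clause of `IsRestrictedAnchor`.**
For `m ≥ 2` and `p ≡ -1 (mod m)` there is a `W(k)`-scheme `𝒳`, projective over `W(k)`, with
`∃ m' ν, 2 ≤ m' ∧ 1 ≤ ν ∧ m' ∣ p ^ ν + 1 ∧ IsFermatLift n m' 𝒳` — verbatim the Fermat alternative
of `Crystalline.IsRestrictedAnchor` / the hypothesis of `SemiregularSeedsOnFermatLifts` — witnessed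
by `m' = m`, `ν = 1` (`m ∣ p + 1`, Shioda–Katsura's supersingularity condition).
[cite: ShiodaKatsura1979, §3] -/
theorem exists_isFermatLift_dvd_pow_add_one (n : ℕ) {m : ℕ} (hm : 2 ≤ m) (h : (p : ZMod m) = -1) :
    ∃ 𝒳 : SchemeOver (WittVector p k), IsProjectiveOverRing 𝒳 ∧
      ∃ m' ν : ℕ, 2 ≤ m' ∧ 1 ≤ ν ∧ m' ∣ p ^ ν + 1 ∧ IsFermatLift n m' 𝒳 := by
  obtain ⟨𝒳, h𝒳, hproj⟩ := exists_isFermatLift p k n m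
  exact ⟨𝒳, hproj, m, 1, hm, le_rfl, by simpa using dvd_add_one_of_eq_neg_one h, h𝒳⟩

end Witt

/-! ### (B2): anchor prime, smooth special Fermat fibre and Fermat lift, packaged -/

/-- **(B2), arithmetic and model-existence clauses.** For every dimension `n ≥ 1` and degree
`m ≥ 2` there is a prime `p` with `p > n + 6` and `p ≡ -1 (mod m)` (hence `m ∣ p + 1`, `p ∤ m`) such
that, over `𝔽̄_p = AlgebraicClosure (ZMod p)`, the special Fermat `n`-fold `Xⁿₘ ⊗ 𝔽̄_p` is smooth
projective and a Fermat variety (`…FermatPrimes.exists_fermat_anchor_prime`), AND over `W(𝔽̄_p)`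
there is a Fermat lift `𝒳`, projective over `W(𝔽̄_p)`, meeting the (F)-clause of
`IsRestrictedAnchor` (`exists_isFermatLift_dvd_pow_add_one`). The remaining clauses of the anchor in
(B2) — `IsPadicAnchor C n 𝒳` for the classical crystalline package `C` (cohomological
supersingularity: Shioda–Katsura 1979 with Tate 1965; torsion-free Hodge cohomology of the smooth
hypersurface `𝒳/W`) and the `φ`-Tate property of `β_dR` (Ogus 1982, Thm. 4.14) — are theorems in
print that enter the route as hypotheses on `C`. [cite: ShiodaKatsura1979, §3] [cite: Ogus1982, Thm. 4.14] -/
theorem exists_fermat_anchor_prime_and_lift (n m : ℕ) (hn : 1 ≤ n) (hm : 2 ≤ m) :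
    ∃ p : ℕ, ∃ _ : Fact p.Prime, n + 6 < p ∧ (p : ZMod m) = -1 ∧ m ∣ p + 1 ∧ ¬ p ∣ m ∧
      IsSmoothProjective n
        (SmoothHypersurface.hypersurface (fermatPolynomial (AlgebraicClosure (ZMod p)) n m)) ∧
      IsFermatVariety n m
        (SmoothHypersurface.hypersurface (fermatPolynomial (AlgebraicClosure (ZMod p)) n m)) ∧
      ∃ 𝒳 : SchemeOver (WittVector p (AlgebraicClosure (ZMod p))), IsProjectiveOverRing 𝒳 ∧
        ∃ m' ν : ℕ, 2 ≤ m' ∧ 1 ≤ ν ∧ m' ∣ p ^ ν + 1 ∧ IsFermatLift n m' 𝒳 := by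
  obtain ⟨p, hp, hpn, h, hdvd, -, hndvd, hsm, hF⟩ :=
    exists_fermat_anchor_prime n m hn (le_trans one_le_two hm)
  exact ⟨p, hp, hpn, h, hdvd, hndvd, hsm, hF,
    exists_isFermatLift_dvd_pow_add_one p (AlgebraicClosure (ZMod p)) n hm h⟩

/-! ### The smooth proper Fermat lift, phrased over `IsFermatLift`; the residual crystalline hypotheses -/

section Smooth

variable (p : ℕ) [Fact p.Prime] (k : Type u) [Field k] [CharP k p]

/-- **The smooth proper Fermat lift, over `Crystalline.IsFermatLift`** (`…FermatLiftModel.exists_fermatLift_model`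
with its first conjunct folded into the carrier): for `p ≠ 2`, `k` algebraically closed of characteristic `p`,
`n ≥ 1`, `m ≥ 1`, `p ∤ m`, there is `𝒳 / W(k)` with `IsFermatLift n m 𝒳`, `IsProjectiveOverRing 𝒳`, reduced,
`WittScheme.IsSmoothProperModel n 𝒳`, and Fermat special / generic / base-changed fibres.
[cite: Hartshorne1977, III Thm. 10.2] -/
theorem exists_isFermatLift_smoothProperModel [IsAlgClosed k] (hp : p ≠ 2) {n m : ℕ} (hn : 1 ≤ n)
    (hm : 1 ≤ m) (hpm : ¬ p ∣ m) :
    ∃ 𝒳 : SchemeOver (WittVector p k),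
      IsFermatLift n m 𝒳 ∧ IsProjectiveOverRing 𝒳 ∧ IsReduced 𝒳.left ∧ IsSmoothProperModel n 𝒳 ∧
      IsFermatVariety n m (specialFibre 𝒳) ∧ IsFermatVariety n m (genericFibre 𝒳) ∧
      ∀ (L : Type u) [Field L] (ι : K(p, k) →+* L),
        IsFermatVariety n m ((baseChangeHom ι).obj (genericFibre 𝒳)) :=
  exists_fermatLift_model p k hp hn hm hpm

/-- **What remains of the (B2) anchor is crystalline.** At an anchor prime `p ≡ -1 (mod m)`, `p > n + 6`
(`n ≥ 1`, `m ≥ 3`), over `W(𝔽̄_p)` there is a Fermat lift `𝒳` — smooth proper model of relative dimension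
`n`, projective over `W`, with Fermat fibres — which is a RESTRICTED ANCHOR (`Crystalline.IsRestrictedAnchor C n 𝒳`,
the hypothesis of `SemiregularSeedsOnRestrictedAnchors` / `…OnFermatLifts`) for EVERY crystalline realization
`C` satisfying the two classical facts the tree cannot yet prove for it: (i) cohomological supersingularity
of `Xⁿₘ ⊗ 𝔽̄_p` (`C.algebraicClasses (specialFibre 𝒳) r = ⊤`; Shioda–Katsura 1979 with Tate 1965, since
`m ∣ p + 1`) and (ii) `p`-torsion-free Hodge cohomology of the smooth hypersurface `𝒳 / W`
(`Motives.hodgeCohomology`; Deligne–Illusie / SGA 7). [cite: ShiodaKatsura1979, §3] -/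
theorem exists_fermat_restrictedAnchor_of_crystalline (n m : ℕ) (hn : 1 ≤ n) (hm : 3 ≤ m) :
    ∃ p : ℕ, ∃ _ : Fact p.Prime, n + 6 < p ∧ (p : ZMod m) = -1 ∧ m ∣ p + 1 ∧ ¬ p ∣ m ∧
      ∃ 𝒳 : SchemeOver (WittVector p (AlgebraicClosure (ZMod p))),
        IsFermatLift n m 𝒳 ∧ IsProjectiveOverRing 𝒳 ∧ IsReduced 𝒳.left ∧ IsSmoothProperModel n 𝒳 ∧
        IsFermatVariety n m (specialFibre 𝒳) ∧ IsFermatVariety n m (genericFibre 𝒳) ∧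
        (∀ (L : Type) [Field L] (ι : K(p, AlgebraicClosure (ZMod p)) →+* L),
          IsFermatVariety n m ((baseChangeHom ι).obj (genericFibre 𝒳))) ∧
        ∀ C : CrystallineRealization p (AlgebraicClosure (ZMod p)),
          (∀ r : ℕ, C.algebraicClasses (specialFibre 𝒳) r = ⊤) →
          (∀ (a b : ℕ) (x : hodgeCohomology 𝒳 a b), (p : ℤ) • x = 0 → x = 0) →
          IsRestrictedAnchor C n 𝒳 := by
  obtain ⟨p, hp, hpn, h, hdvd, hpm, 𝒳, hF, hproj, hred, hmodel, hs, hg, hL⟩ :=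
    exists_fermat_anchor_model n m hn hm
  refine ⟨p, hp, hpn, h, hdvd, hpm, 𝒳, hF, hproj, hred, hmodel, hs, hg, hL, fun C hss htf => ?_⟩
  exact ⟨⟨hmodel, hproj, hpn, hss, htf⟩, Or.inr ⟨m, 1, by omega, le_rfl, by simpa using hdvd, hF⟩⟩

end Smooth

end Summit.HodgeConjecture.HodgeConjecture.Theorems.AnchorsAtGenericHodgeLocusPoints

end
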